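import Summits.BirchSwinnertonDyer.BirchSwinnertonDyer.Theorems.ManinLocalTwoThreeThreeShiftDescentTwentySeven
import Mathlib.GroupTheory.FreeGroup.Basic
import HarnessLib

/-!
# The HEISENBERG LIFT on `Γ₀(M)` from the freeness of `Γ₀(M)/{±1}` (E-es-108), and the explicit pair `(μ|_A, μ|_B)` on `Γ₀(3m)`
# (route `ManinLocalTwoThree`, cell bsd-f2-manin; crux C3 `ManinPrimeToThreeAtNine` stmt-BirchSwinnertonDyer-22968; LEAD seat p1
# gen 11; es MEMO-es §37.13 (C) route (F), adopted by the C3 LEAD as P-es-6)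

PURPOSE.  The `9 ∥ M` steps of es's 3-shift descent theorems E-es-98 (III) and E-es-106 (V) need ONE explicit «non-inflated
compatible pair» on `G = Γ₀(3m) ⊇ A = {3 ∣ b}, B = Γ₀(9m)`, `3 ∣ m` (MEMO-es §37.13 (A)); no CONGRUENCE character supplies it
(§37.13 (C)).  The witness is the HEISENBERG LIFT `μ` of `β(g) = a_g b_g`, `λ(g) = a_g · c_g/(3m)` (mod 3):
`μ(gh) = μ(g) + μ(h) + β(g)λ(h)`, which exists because `Γ₀(3m)/{±1}` is FREE when `9 ∣ 3m` — the tree's named fact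
`Literature.NumberTheory.ModularForms.gamma0_eq_negOne_prod_free_of_nine_dvd` (Kulkarni 1991; es row E-es-108), whose
single-level shape is taken here as the hypotheses `himg`, `huniq`.
CONTENTS (PROVED, no sorry, no Prop-valued definitions): §1 unitriangular `heisU x y z ∈ SL₃(𝔽₃)`; §2 **`exists_heisenbergLift`**
(`θ = FreeGroup.lift (i ↦ U(β(e i), λ(e i), 0))`, `μ(± e w) := θ(w)₀₂`); §3 the characters `betaCh`, `lamCh` of `Γ₀(3m)`,
additivity, `β|_A = 0`, `λ|_B = 0`, and for any Heisenberg `μ`: additive on `A` and on `B`, kills cubes, and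
**`heis_conj_Q1_sub`: `μ(T Q₁ T⁻¹) − μ(Q₁) = −1`** (`δ(p_H) ≠ 0`).  The descent theorems are in the sibling
`…ThreeShiftHeisenbergDescent.lean`.  Nothing about BSD, Manin's conjecture, E-es-94♯ or C3 is asserted or proved here.
Reference: HOME/MEMO-es.md §37.13 [cite: Kulkarni1991, Thm. 3.2 and Thm. 3.3] [cite: DarmonDiamondTaylor1995, Lemma 4.28 (p. 135)].
-/

set_option autoImplicit false
set_option linter.dupNamespace false

open scoped MatrixGroups

open CongruenceSubgroup Matrix.SpecialLinearGroup
  Summit.BirchSwinnertonDyer.Rank1Residual.ManinAdditive.NineShiftEqualiser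

namespace Summit.BirchSwinnertonDyer.BirchSwinnertonDyer.Theorems.ManinLocalTwoThree

namespace ThreeShiftDescent

/-! ### §1. Unitriangular `3 × 3` matrices over `𝔽₃` (the Heisenberg group of order 27) -/

section Heisenberg

/-- The unitriangular matrix `U(x, y, z) = (1 x z; 0 1 y; 0 0 1) ∈ SL₃(𝔽₃)`. [folklore] -/
def heisU (x y z : ZMod 3) : SL(3, ZMod 3) :=
  ⟨!![1, x, z; 0, 1, y; 0, 0, 1], by simp [Matrix.det_fin_three]⟩

/-- Heisenberg multiplication: `U(x,y,z) U(x',y',z') = U(x+x', y+y', z+z'+x y')`. [folklore] -/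
theorem heisU_mul (x y z x' y' z' : ZMod 3) :
    heisU x y z * heisU x' y' z' = heisU (x + x') (y + y') (z + z' + x * y') := by
  apply Subtype.ext
  simp only [heisU, Matrix.SpecialLinearGroup.coe_mul]
  ext i j
  fin_cases i <;> fin_cases j <;> simp [Matrix.mul_apply, Fin.sum_univ_three] <;> ring

/-- `U(0,0,0) = 1`. [folklore] -/
theorem heisU_zero : heisU 0 0 0 = 1 := by
  apply Subtype.ext
  simp only [heisU, Matrix.SpecialLinearGroup.coe_one]
  ext i j
  fin_cases i <;> fin_cases j <;> simp

/-- `U(x,y,z)⁻¹ = U(−x, −y, x y − z)`. [folklore] -/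
theorem heisU_inv (x y z : ZMod 3) : (heisU x y z)⁻¹ = heisU (-x) (-y) (x * y - z) := by
  rw [inv_eq_iff_mul_eq_one, heisU_mul, ← heisU_zero]
  congr 1 <;> ring

/-- The `(0,2)` entry of `U(x,y,z)` is `z`. [folklore] -/
theorem heisU_apply_02 (x y z : ZMod 3) : (heisU x y z) 0 2 = z := rfl

end Heisenberg

/-! ### §2. The Heisenberg lift from a free presentation modulo `±1` -/

section Lift

variable {M : ℕ}

/-- An additive `𝔽₃`-character of `Γ₀(M)` kills `1`. [folklore] -/
theorem isAddChar_map_one {φ : Gamma0 M → ZMod 3} (hφ : IsAddChar φ) : φ 1 = 0 := by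
  have h := hφ 1 1; rw [mul_one] at h
  have key : ∀ x : ZMod 3, x = x + x → x = 0 := by decide
  exact key _ h

/-- An additive `𝔽₃`-character of `Γ₀(M)` is odd. [folklore] -/
theorem isAddChar_map_inv {φ : Gamma0 M → ZMod 3} (hφ : IsAddChar φ) (γ : Gamma0 M) : φ γ⁻¹ = -φ γ := by
  have h := hφ γ γ⁻¹
  rw [mul_inv_cancel, isAddChar_map_one hφ] at h
  exact eq_neg_of_add_eq_zero_right h.symm

/-- `-1 ∈ Γ₀(M)`. [folklore] -/
theorem negOne_mem_Gamma0 : (-1 : SL(2, ℤ)) ∈ Gamma0 M := by rw [Gamma0_mem]; simp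

/-- An additive `𝔽₃`-character of `Γ₀(M)` kills `−1` (`2 φ(−1) = φ(1) = 0`). [folklore] -/
theorem isAddChar_map_negOne {φ : Gamma0 M → ZMod 3} (hφ : IsAddChar φ) :
    φ ⟨-1, negOne_mem_Gamma0⟩ = 0 := by
  have h := hφ ⟨-1, negOne_mem_Gamma0⟩ ⟨-1, negOne_mem_Gamma0⟩
  have e : (⟨-1, negOne_mem_Gamma0⟩ * ⟨-1, negOne_mem_Gamma0⟩ : Gamma0 M) = 1 := Subtype.ext (by simp)
  rw [e, isAddChar_map_one hφ] at h
  have key : ∀ x : ZMod 3, 0 = x + x → x = 0 := by decide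
  exact key _ h

/-- The sign element `±1 ∈ SL₂(ℤ)` (as in the named fact: `if b then -1 else 1`). [folklore] -/
def sgn (b : Bool) : SL(2, ℤ) := if b then -1 else 1

/-- `±1` is central in `SL₂(ℤ)`. [folklore] -/
theorem sgn_mul_comm (b : Bool) (g : SL(2, ℤ)) : sgn b * g = g * sgn b := by
  unfold sgn; split_ifs <;> simp

/-- `sgn b * sgn b' = sgn (b xor b')`. [folklore] -/
theorem sgn_mul_sgn (b b' : Bool) : sgn b * sgn b' = sgn (xor b b') := by
  unfold sgn; cases b <;> cases b' <;> simp

/-- `sgn b ∈ Γ₀(M)`. [folklore] -/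
theorem sgn_mem (b : Bool) : sgn b ∈ Gamma0 M := by
  unfold sgn; split_ifs; exacts [negOne_mem_Gamma0, one_mem _]

/-- An additive `𝔽₃`-character kills `sgn b`. [folklore] -/
theorem isAddChar_map_sgn {φ : Gamma0 M → ZMod 3} (hφ : IsAddChar φ) (b : Bool) : φ ⟨sgn b, sgn_mem b⟩ = 0 := by
  cases b
  · have e : (⟨sgn false, sgn_mem false⟩ : Gamma0 M) = 1 := Subtype.ext (by simp [sgn])
    rw [e, isAddChar_map_one hφ]
  · have e : (⟨sgn true, sgn_mem true⟩ : Gamma0 M) = ⟨-1, negOne_mem_Gamma0⟩ := Subtype.ext (by simp [sgn])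
    rw [e, isAddChar_map_negOne hφ]

variable {ι : Type} {e : FreeGroup ι →* SL(2, ℤ)}

/-- `e w` as an element of `Γ₀(M)`. [folklore] -/
def eG (himg : ∀ w : FreeGroup ι, e w ∈ Gamma0 M) (w : FreeGroup ι) : Gamma0 M := ⟨e w, himg w⟩

/-- `eG` is multiplicative. [folklore] -/
theorem eG_mul (himg : ∀ w : FreeGroup ι, e w ∈ Gamma0 M) (w w' : FreeGroup ι) :
    eG himg (w * w') = eG himg w * eG himg w' :=
  Subtype.ext (by simp [eG])

/-- `eG 1 = 1`. [folklore] -/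
theorem eG_one (himg : ∀ w : FreeGroup ι, e w ∈ Gamma0 M) : eG himg 1 = 1 := Subtype.ext (by simp [eG])

/-- `eG w⁻¹ = (eG w)⁻¹`. [folklore] -/
theorem eG_inv (himg : ∀ w : FreeGroup ι, e w ∈ Gamma0 M) (w : FreeGroup ι) : eG himg w⁻¹ = (eG himg w)⁻¹ :=
  Subtype.ext (by simp [eG])

variable (β lam : Gamma0 M → ZMod 3)

/-- The Heisenberg representation `θ : FreeGroup ι →* SL₃(𝔽₃)`, generator `i ↦ U(β(e i), λ(e i), 0)`. [folklore] -/
noncomputable def theta (himg : ∀ w : FreeGroup ι, e w ∈ Gamma0 M) : FreeGroup ι →* SL(3, ZMod 3) :=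
  FreeGroup.lift fun i => heisU (β (eG himg (FreeGroup.of i))) (lam (eG himg (FreeGroup.of i))) 0

/-- **`θ(w)` is unitriangular with off-diagonal `β(e w)`, `λ(e w)`**: `θ(w) = U(β(e w), λ(e w), z)` for some `z`
(induction on `w`; additivity of `β`, `λ`). [folklore] -/
theorem theta_eq (himg : ∀ w : FreeGroup ι, e w ∈ Gamma0 M) (hβ : IsAddChar β) (hlam : IsAddChar lam)
    (w : FreeGroup ι) : ∃ z : ZMod 3, theta β lam himg w = heisU (β (eG himg w)) (lam (eG himg w)) z := by
  induction w using FreeGroup.induction_on with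
  | C1 => exact ⟨0, by rw [map_one, eG_one, isAddChar_map_one hβ, isAddChar_map_one hlam, heisU_zero]⟩
  | of i => exact ⟨0, by simp [theta]⟩
  | inv_of i ih =>
      obtain ⟨z, hz⟩ := ih
      refine ⟨β (eG himg (FreeGroup.of i)) * lam (eG himg (FreeGroup.of i)) - z, ?_⟩
      rw [map_inv, hz, heisU_inv, eG_inv, isAddChar_map_inv hβ, isAddChar_map_inv hlam]
  | mul x y hx hy =>
      obtain ⟨zx, hzx⟩ := hx
      obtain ⟨zy, hzy⟩ := hy
      refine ⟨zx + zy + β (eG himg x) * lam (eG himg y), ?_⟩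
      rw [map_mul, hzx, hzy, heisU_mul, eG_mul, hβ, hlam]

/-- The central coordinate `z(w) := θ(w)₀₂`. [folklore] -/
noncomputable def zc (himg : ∀ w : FreeGroup ι, e w ∈ Gamma0 M) (w : FreeGroup ι) : ZMod 3 :=
  (theta β lam himg w) 0 2

/-- `θ(w) = U(β(e w), λ(e w), z(w))`. [folklore] -/
theorem theta_eq_heisU (himg : ∀ w : FreeGroup ι, e w ∈ Gamma0 M) (hβ : IsAddChar β) (hlam : IsAddChar lam)
    (w : FreeGroup ι) : theta β lam himg w = heisU (β (eG himg w)) (lam (eG himg w)) (zc β lam himg w) := by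
  obtain ⟨z, hz⟩ := theta_eq β lam himg hβ hlam w
  rw [zc, hz, heisU_apply_02]

/-- **The Heisenberg cocycle identity on the free group**: `z(w w') = z(w) + z(w') + β(e w) λ(e w')`. [folklore] -/
theorem zc_mul (himg : ∀ w : FreeGroup ι, e w ∈ Gamma0 M) (hβ : IsAddChar β) (hlam : IsAddChar lam)
    (w w' : FreeGroup ι) :
    zc β lam himg (w * w') = zc β lam himg w + zc β lam himg w' + β (eG himg w) * lam (eG himg w') := by
  have h := theta_eq_heisU β lam himg hβ hlam (w * w')
  rw [map_mul, theta_eq_heisU β lam himg hβ hlam w, theta_eq_heisU β lam himg hβ hlam w', heisU_mul] at h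
  have := congrArg (fun g : SL(3, ZMod 3) => g 0 2) h
  simp only [heisU_apply_02] at this
  exact this.symm

variable (huniq : ∀ γ : SL(2, ℤ), γ ∈ Gamma0 M →
  ∃! p : FreeGroup ι × Bool, γ = (if p.2 then (-1 : SL(2, ℤ)) else 1) * e p.1)

/-- The free coordinates `(w, ±)` of `γ = ± e(w)`. [folklore] -/
noncomputable def coord (γ : Gamma0 M) : FreeGroup ι × Bool := (huniq γ γ.2).choose

/-- `γ = sgn · e(coord γ)`. [folklore] -/
theorem coord_spec (γ : Gamma0 M) : (γ : SL(2, ℤ)) = sgn (coord huniq γ).2 * e (coord huniq γ).1 :=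
  (huniq γ γ.2).choose_spec.1

/-- Uniqueness of the coordinates. [folklore] -/
theorem coord_unique (γ : Gamma0 M) (w : FreeGroup ι) (b : Bool) (h : (γ : SL(2, ℤ)) = sgn b * e w) :
    coord huniq γ = (w, b) :=
  ((huniq γ γ.2).choose_spec.2 (w, b) h).symm ▸ rfl

/-- **Coordinates are multiplicative up to sign**: `coord (γ γ') = (w w', b xor b')` (`±1` is central). [folklore] -/
theorem coord_mul (γ γ' : Gamma0 M) :
    coord huniq (γ * γ') = ((coord huniq γ).1 * (coord huniq γ').1, xor (coord huniq γ).2 (coord huniq γ').2) := by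
  apply coord_unique
  rw [show ((γ * γ' : Gamma0 M) : SL(2, ℤ)) = (γ : SL(2, ℤ)) * γ' from rfl, coord_spec huniq γ, coord_spec huniq γ',
    map_mul, ← sgn_mul_sgn]
  rw [mul_assoc, ← mul_assoc (e _) (sgn _), ← sgn_mul_comm, mul_assoc, mul_assoc]

/-- `β(γ) = β(e(coord γ))` (the sign is killed by `β`). [folklore] -/
theorem apply_eq_apply_eG_coord (hβ : IsAddChar β) (himg : ∀ w : FreeGroup ι, e w ∈ Gamma0 M) (γ : Gamma0 M) :
    β γ = β (eG himg (coord huniq γ).1) := by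
  have e1 : γ = ⟨sgn (coord huniq γ).2, sgn_mem _⟩ * eG himg (coord huniq γ).1 :=
    Subtype.ext (by rw [coord_spec huniq γ]; rfl)
  rw [e1, hβ, isAddChar_map_sgn hβ, zero_add, ← e1]

/-- **THE HEISENBERG LIFT (from E-es-108's shape at one level).**  If every `γ ∈ Γ₀(M)` is `± e(w)` for a unique
`(w, ±)`, `e : FreeGroup ι →* SL₂(ℤ)` with image in `Γ₀(M)`, then for every pair of additive characters
`β, λ : Γ₀(M) → 𝔽₃` there is `μ : Γ₀(M) → 𝔽₃` with `μ(γγ') = μ(γ) + μ(γ') + β(γ)λ(γ')` — a homomorphism to the Heisenberg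
group lifting `(β, λ)`; equivalently `β ∪ λ = 0` in `H²(Γ₀(M); 𝔽₃)`. [folklore] -/
theorem exists_heisenbergLift (himg : ∀ w : FreeGroup ι, e w ∈ Gamma0 M)
    (huniq : ∀ γ : SL(2, ℤ), γ ∈ Gamma0 M →
      ∃! p : FreeGroup ι × Bool, γ = (if p.2 then (-1 : SL(2, ℤ)) else 1) * e p.1)
    (hβ : IsAddChar β) (hlam : IsAddChar lam) :
    ∃ μ : Gamma0 M → ZMod 3, ∀ γ γ' : Gamma0 M, μ (γ * γ') = μ γ + μ γ' + β γ * lam γ' := by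
  refine ⟨fun γ => zc β lam himg (coord huniq γ).1, fun γ γ' => ?_⟩
  simp only
  rw [coord_mul, zc_mul β lam himg hβ hlam, ← apply_eq_apply_eG_coord β huniq hβ himg γ,
    ← apply_eq_apply_eG_coord lam huniq hlam himg γ']

end Lift

/-! ### §3. The characters `β = ab`, `λ = a·c/(3m)` of `Γ₀(3m)` and the explicit pair `(μ|_A, μ|_B)` -/

section Pair

variable {m : ℕ}

/-- Mod-3 facts for `(a b; c d)` of determinant `1` with `3 ∣ c`: `c ≡ 0`, `ad ≡ 1`, `a² ≡ 1`. [folklore] -/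
theorem modThree_of_det {a b c d : ℤ} (h : a * d - b * c = 1) (hc : (3 : ℤ) ∣ c) :
    ((c : ℤ) : ZMod 3) = 0 ∧ ((a : ℤ) : ZMod 3) * (d : ZMod 3) = 1 ∧ ((a : ℤ) : ZMod 3) * (a : ZMod 3) = 1 := by
  have hc3 : ((c : ℤ) : ZMod 3) = 0 := (ZMod.intCast_zmod_eq_zero_iff_dvd c 3).mpr hc
  have had : ((a : ℤ) : ZMod 3) * (d : ZMod 3) = 1 := by
    have := congrArg (fun x : ℤ => (x : ZMod 3)) h
    push_cast at this
    rw [hc3, mul_zero, sub_zero] at this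
    exact this
  have key : ∀ x y : ZMod 3, x * y = 1 → x * x = 1 := by decide
  exact ⟨hc3, had, key _ _ had⟩

/-- `3 ∣ c` for `(a b; c d) ∈ Γ₀(3m)`. [folklore] -/
theorem three_dvd_of_mem {c : ℤ} (hc : ((3 * m : ℕ) : ℤ) ∣ c) : (3 : ℤ) ∣ c :=
  (show (3 : ℤ) ∣ ((3 * m : ℕ) : ℤ) from ⟨m, by push_cast; ring⟩).trans hc

/-- **`β(γ) := a_γ b_γ mod 3`** on `Γ₀(3m)`. [folklore] -/
def betaCh (m : ℕ) (γ : Gamma0 (3 * m)) : ZMod 3 :=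
  ((((γ : SL(2, ℤ)) 0 0 : ℤ) * (γ : SL(2, ℤ)) 0 1 : ℤ) : ZMod 3)

/-- **`λ(γ) := a_γ · (c_γ / (3m)) mod 3`** on `Γ₀(3m)`. [folklore] -/
def lamCh (m : ℕ) (γ : Gamma0 (3 * m)) : ZMod 3 :=
  ((((γ : SL(2, ℤ)) 0 0 : ℤ) * (((γ : SL(2, ℤ)) 1 0 : ℤ) / ((3 * m : ℕ) : ℤ)) : ℤ) : ZMod 3)

/-- `β` on an explicit matrix. [folklore] -/
theorem betaCh_g0Of (a b c d : ℤ) (h : a * d - b * c = 1) (hc : ((3 * m : ℕ) : ℤ) ∣ c) :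
    betaCh m (g0Of a b c d h hc) = ((a * b : ℤ) : ZMod 3) := rfl

/-- `λ` on an explicit matrix `(a b; 3m k, d)` (`m > 0`): `λ = a k`. [folklore] -/
theorem lamCh_g0Of (hm : 0 < m) (a b d k : ℤ) (h : a * d - b * ((3 * m : ℕ) * k) = 1)
    (hc : ((3 * m : ℕ) : ℤ) ∣ (3 * m : ℕ) * k) :
    lamCh m (g0Of a b ((3 * m : ℕ) * k) d h hc) = ((a * k : ℤ) : ZMod 3) := by
  have h3m : ((3 * m : ℕ) : ℤ) ≠ 0 := by positivity
  show ((((a : ℤ)) * (((3 * m : ℕ) : ℤ) * k / ((3 * m : ℕ) : ℤ)) : ℤ) : ZMod 3) = _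
  rw [Int.mul_ediv_cancel_left k h3m]

/-- Every element of `Γ₀(3m)` is `(a b; 3m k, d)`. [folklore] -/
theorem exists_eq_g0Of_mul (x : Gamma0 (3 * m)) :
    ∃ (a b d k : ℤ) (h : a * d - b * ((3 * m : ℕ) * k) = 1) (hc : ((3 * m : ℕ) : ℤ) ∣ (3 * m : ℕ) * k),
      x = g0Of a b ((3 * m : ℕ) * k) d h hc := by
  obtain ⟨a, b, c, d, h, hc, rfl⟩ := exists_eq_g0Of x
  obtain ⟨k, rfl⟩ := hc
  exact ⟨a, b, d, k, h, _, rfl⟩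

/-- **`β` is additive on `Γ₀(3m)`** (`a² ≡ 1`, `c ≡ 0 (mod 3)`). [folklore] -/
theorem isAddChar_betaCh : IsAddChar (betaCh m) := by
  intro x y
  obtain ⟨a, b, c, d, h, hc, rfl⟩ := exists_eq_g0Of x
  obtain ⟨a', b', c', d', h', hc', rfl⟩ := exists_eq_g0Of y
  rw [g0Of_mul a b c d a' b' c' d' h hc h' hc' (det_mul_entries h h')
      (dvd_add (Dvd.dvd.mul_right hc _) (Dvd.dvd.mul_left hc' _)),
    betaCh_g0Of, betaCh_g0Of, betaCh_g0Of]
  obtain ⟨_, _, haa⟩ := modThree_of_det h (three_dvd_of_mem hc)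
  obtain ⟨hc3', had', _⟩ := modThree_of_det h' (three_dvd_of_mem hc')
  push_cast
  rw [hc3']
  linear_combination (↑a' * ↑b') * haa + (↑a * ↑b) * had'

/-- **`λ` is additive on `Γ₀(3m)`** (`m > 0`; `a'² ≡ 1`, `a d ≡ 1 (mod 3)`). [folklore] -/
theorem isAddChar_lamCh (hm : 0 < m) : IsAddChar (lamCh m) := by
  intro x y
  obtain ⟨a, b, d, k, h, hc, rfl⟩ := exists_eq_g0Of_mul x
  obtain ⟨a', b', d', k', h', hc', rfl⟩ := exists_eq_g0Of_mul y
  have hc'' : ((3 * m : ℕ) : ℤ) ∣ (3 * m : ℕ) * (k * a' + d * k') := Dvd.intro _ rfl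
  have e1 : (g0Of a b ((3 * m : ℕ) * k) d h hc * g0Of a' b' ((3 * m : ℕ) * k') d' h' hc' : Gamma0 (3 * m)) =
      g0Of (a * a' + b * ((3 * m : ℕ) * k')) (a * b' + b * d') ((3 * m : ℕ) * (k * a' + d * k'))
        ((3 * m : ℕ) * k * b' + d * d') (by linear_combination (det_mul_entries h h')) hc'' := by
    rw [g0Of_mul _ _ _ _ _ _ _ _ h hc h' hc' (det_mul_entries h h')
      (dvd_add (Dvd.dvd.mul_right hc _) (Dvd.dvd.mul_left hc' _))]
    exact g0Of_congr rfl rfl (by ring) rfl _ _ _ _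
  rw [e1, lamCh_g0Of hm, lamCh_g0Of hm, lamCh_g0Of hm]
  obtain ⟨_, had, _⟩ := modThree_of_det h (three_dvd_of_mem hc)
  obtain ⟨hc3', _, haa'⟩ := modThree_of_det h' (three_dvd_of_mem hc')
  push_cast at hc3' ⊢
  linear_combination (↑a * ↑k) * haa' + (↑a' * ↑k') * had + (↑b * (↑k * ↑a' + ↑d * ↑k')) * hc3'

/-- `β` vanishes on `A = {3 ∣ b}`. [folklore] -/
theorem betaCh_eq_zero_of_mem_subA {x : Gamma0 (3 * m)} (hx : x ∈ subA m) : betaCh m x = 0 := by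
  obtain ⟨a, b, c, d, h, hc, rfl⟩ := exists_eq_of_mem_subA hx
  rw [betaCh_g0Of]
  push_cast
  rw [show (3 : ZMod 3) = 0 from rfl]
  ring

/-- `λ` vanishes on `B = Γ₀(9m)` (`m > 0`). [folklore] -/
theorem lamCh_eq_zero_of_mem_subB (hm : 0 < m) {x : Gamma0 (3 * m)} (hx : x ∈ subB m) : lamCh m x = 0 := by
  obtain ⟨a, b, c, d, h, hc, hc9, rfl⟩ := exists_eq_of_mem_subB hx
  obtain ⟨k, hk⟩ := hc9
  have hk' : c = (3 * m : ℕ) * (3 * k) := by rw [hk]; push_cast; ring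
  have e1 : (g0Of a b c d h hc : Gamma0 (3 * m)) =
      g0Of a b ((3 * m : ℕ) * (3 * k)) d (by rw [← hk']; exact h) (Dvd.intro _ rfl) :=
    g0Of_congr rfl rfl hk' rfl _ _ _ _
  rw [e1, lamCh_g0Of hm]
  push_cast
  rw [show (3 : ZMod 3) = 0 from rfl]
  ring

/-- `β(T) = 1`. [folklore] -/
theorem betaCh_Tpow_one : betaCh m (Tpow (3 * m) 1) = 1 := by
  rw [Tpow, betaCh_g0Of]; push_cast; ring

/-- `λ(T^k) = 0`. [folklore] -/
theorem lamCh_Tpow (k : ℤ) : lamCh m (Tpow (3 * m) k) = 0 := by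
  show ((((1 : ℤ)) * ((0 : ℤ) / ((3 * m : ℕ) : ℤ)) : ℤ) : ZMod 3) = 0
  simp

/-- `λ(Q₁) = −1` (`Q₁ = (1 − 3m, 3m; −3m, 1 + 3m)`, `m > 0`). [folklore] -/
theorem lamCh_Q1 (hm : 0 < m) : lamCh m (Q1 m) = -1 := by
  have e1 : Q1 m = g0Of (1 - 3 * m) (3 * m) ((3 * m : ℕ) * (-1)) (1 + 3 * m) (by push_cast; ring) (Dvd.intro _ rfl) := by
    unfold Q1; exact g0Of_congr rfl rfl (by push_cast; ring) rfl _ _ _ _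
  rw [e1, lamCh_g0Of hm]
  push_cast
  rw [show (3 : ZMod 3) = 0 from rfl]
  ring

variable (μ : Gamma0 (3 * m) → ZMod 3)
  (hμ : ∀ x y : Gamma0 (3 * m), μ (x * y) = μ x + μ y + betaCh m x * lamCh m y)

include hμ

/-- A Heisenberg function kills `1`. [folklore] -/
theorem heis_map_one : μ 1 = 0 := by
  have h := hμ 1 1
  rw [mul_one, isAddChar_map_one isAddChar_betaCh, zero_mul, add_zero] at h
  have key : ∀ x : ZMod 3, x = x + x → x = 0 := by decide
  exact key _ h

/-- A Heisenberg function on inverses: `μ(x⁻¹) = −μ(x) + β(x)λ(x)`. [folklore] -/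
theorem heis_map_inv (hm : 0 < m) (x : Gamma0 (3 * m)) : μ x⁻¹ = -μ x + betaCh m x * lamCh m x := by
  have h := hμ x x⁻¹
  rw [mul_inv_cancel, heis_map_one μ hμ, isAddChar_map_inv (isAddChar_lamCh hm)] at h
  linear_combination -h

/-- **A Heisenberg function kills cubes**: `μ(x³) = 3μ(x) + 3β(x)λ(x) = 0`. [folklore] -/
theorem heis_map_cube (x : Gamma0 (3 * m)) : μ (x * x * x) = 0 := by
  rw [hμ, hμ, isAddChar_betaCh]
  have : μ x + μ x + betaCh m x * lamCh m x + μ x + (betaCh m x + betaCh m x) * lamCh m x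
      = 3 * (μ x + betaCh m x * lamCh m x) := by ring
  rw [this, show (3 : ZMod 3) = 0 from rfl, zero_mul]

/-- **`μ` is additive on `A`** (`β|_A = 0`). [folklore] -/
theorem heis_add_subA : ∀ x ∈ subA m, ∀ y ∈ subA m, μ (x * y) = μ x + μ y := by
  intro x hx y _
  rw [hμ, betaCh_eq_zero_of_mem_subA hx, zero_mul, add_zero]

/-- **`μ` is additive on `B`** (`λ|_B = 0`, `m > 0`). [folklore] -/
theorem heis_add_subB (hm : 0 < m) : ∀ x ∈ subB m, ∀ y ∈ subB m, μ (x * y) = μ x + μ y := by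
  intro x _ y hy
  rw [hμ, lamCh_eq_zero_of_mem_subB hm hy, mul_zero, add_zero]

/-- **`δ(p_H) = μ(T Q₁ T⁻¹) − μ(Q₁) = β(T)λ(Q₁) = −1 ≠ 0`** — the non-inflatedness of the Heisenberg pair
(MEMO-es §37.13 (C)). [folklore] -/
theorem heis_conj_Q1_sub (hm : 0 < m) :
    μ (Tpow (3 * m) 1 * Q1 m * (Tpow (3 * m) 1)⁻¹) - μ (Q1 m) = -1 := by
  rw [hμ, hμ, heis_map_inv μ hμ hm, isAddChar_betaCh, isAddChar_map_inv (isAddChar_lamCh hm), betaCh_Tpow_one,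
    lamCh_Tpow, lamCh_Q1 hm]
  ring

end Pair

end ThreeShiftDescent

end Summit.BirchSwinnertonDyer.BirchSwinnertonDyer.Theorems.ManinLocalTwoThree
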